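import Summits.Ventures.Crystal3D.Theorems.StickyWulffConstantCoaxialWallLawSeamFullCensusSoundA
import HarnessLib

/-!
# FULL-CENSUS SOUNDNESS, part B: E1 / split / free-ball bookkeeping preserves the interpretation, and `run_sound`
# (crux `CoaxialWallLaw`, stmt-Ventures-19481; lane F 'Certificates' v8.4, registered stub `stub_satCensus11Full : TailResidue.SatCensus11Full`)

HONEST FRAMING. Venture `Summits/Ventures/Crystal3D` (cell `crystal3d-full`); helper for `stub_satCensus11Full`; sequel of '…SeamFullCensusSoundA'.  `inv_addFull` /
`inv_addTwin` (the two branches of `e1_step` extend the interpretation), `inv_sat` / `inv_uns` / `inv_insert`, `exists_candidate` (in the free-ball pattern an eleventh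
contact exists and is one of the three candidates, by `free_ball`), and **`run_sound`**: under `Hyp`, NO certificate is accepted by `run` from a state satisfying `Inv` —
induction on the certificate (E1 nodes: `e1_step`; splits: kissing bound + «unsaturated contacts coincide»; free-ball nodes: `exists_candidate`; twin-vacancy leaves:
`false_of_vacLeaf`; conflict leaves: `false_of_checkW`).
WHAT THIS IS NOT: no census statement is proved here (that is '…SeamFullCensusCert'); F-C1 not moved.
-/

noncomputable section

namespace Summit.Ventures.Crystal3D.Theorems

namespace TailResidue

namespace FullCensus

open Summit.Ventures.Crystal3D Finset EndRowFloor NearIdentity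
open scoped InnerProductSpace

variable {X : Finset (EuclideanSpace ℝ (Fin 3))} {G' : EuclideanSpace ℝ (Fin 3) ≃ₗᵢ[ℝ] EuclideanSpace ℝ (Fin 3)} {q₀ : EuclideanSpace ℝ (Fin 3)}

attribute [local irreducible] insertV addAll fullList ownList mirList farList tabs

/-! ### §5 Bookkeeping preserves the interpretation -/

/-- `TT` of a sum with a table slot. -/
theorem TT_add_gOf (κ : List ℕ) (p : Q3) (i : Fin 12) : TT G' q₀ (Q3.add p (gOf (tabs κ) i)) = T G' q₀ (p.toV + (frameOf κ).g i) := by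
  rw [TT, Q3.toV_add, (tabOK_tabs κ).2.2.1 i]

/-- `TT` of a sum with a mirror position. -/
theorem TT_add_mir3 (κ : List ℕ) (p : Q3) (i : Fin 12) (c : Fin 8) :
    TT G' q₀ (Q3.add p (mir3 (tabs κ) i c)) = T G' q₀ (p.toV + mirQ (frameOf κ).g (frameOf κ).w i c) := by
  rw [TT, Q3.toV_add, toV_mir3]

/-- The star test of the checker gives the star hypothesis of `e1_step`. -/
theorem star_of_starOK {st : St} (hinv : Inv X G' q₀ st) {κ : List ℕ} {p : Q3} {j : Fin 12} (h : starOK st (tabs κ) p j = true) :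
    ∀ i : Fin 12, 0 < dz (slotInt i) (slotInt j) → T G' q₀ (p.toV + (frameOf κ).g i) ∈ X := by
  intro i hi
  simp only [starOK, List.all_eq_true, List.mem_range, Bool.or_eq_true, Bool.not_eq_true', decide_eq_false_iff_not, decide_eq_true_eq] at h
  rcases h i i.2 with h | h
  · exfalso; apply h; rw [ss_eq]; exact_mod_cast hi
  · rw [← TT_add_gOf]; exact hinv.pres _ h

/-- The own-side test of the checker. -/
theorem ownSide_of (j : Fin 12) (c : Fin 8) (h : ∀ i : Fin 12, 0 < dz (slotInt i) (slotInt j) → dz (slotInt i) (cubeInt c) ≤ 0) : ownSide j c = true := by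
  simp only [ownSide, List.all_eq_true, List.mem_range, Bool.or_eq_true, Bool.not_eq_true', decide_eq_false_iff_not, decide_eq_true_eq]
  intro i hi
  by_cases hpos : 0 < ss i j
  · right
    rw [ss_eq ⟨i, hi⟩ j] at hpos
    have := h ⟨i, hi⟩ (by exact_mod_cast hpos)
    rw [sc_eq ⟨i, hi⟩ c]; exact_mod_cast this
  · left; exact hpos

/-- **FULL bookkeeping**: after the FULL branch of `e1_step` the enlarged state is interpreted. -/
theorem inv_addFull {st : St} (hinv : Inv X G' q₀ st) {κ : List ℕ} {p : Q3} (hp : p ∈ st.sat)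
    (hall : ∀ i : Fin 12, T G' q₀ (p.toV + (frameOf κ).g i) ∈ X)
    (hcont : ∀ z ∈ X, dist (T G' q₀ p.toV) z = 1 → ∃ i : Fin 12, z = T G' q₀ (p.toV + (frameOf κ).g i)) : Inv X G' q₀ (addFull st p κ) where
  pres := by
    intro a ha
    rcases mem_addAll.1 ha with ha | ha
    · exact hinv.pres a ha
    · obtain ⟨i, rfl⟩ := mem_fullList.1 ha
      rw [TT_add_gOf]; exact hall i
  nodup := nodup_addAll hinv.nodup
  sat := hinv.sat
  dzn := by
    intro pd hpd
    rcases List.mem_cons.1 hpd with rfl | hpd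
    · refine ⟨hinv.sat p hp, fun z hz hd => ?_⟩
      obtain ⟨i, rfl⟩ := hcont z hz hd
      exact ⟨Q3.add p (gOf (tabs κ) i), mem_fullList.2 ⟨i, rfl⟩, (TT_add_gOf κ p i).symm⟩
    · exact hinv.dzn pd hpd
  emp := hinv.emp
  uns := hinv.uns

/-- **TWIN bookkeeping**: after the twin branch `c` of `e1_step` the enlarged state is interpreted. -/
theorem inv_addTwin {st : St} (hinv : Inv X G' q₀ st) {κ : List ℕ} {p : Q3} (hp : p ∈ st.sat) {c : Fin 8}
    (hown : ∀ i : Fin 12, dz (slotInt i) (cubeInt c) ≤ 0 → T G' q₀ (p.toV + (frameOf κ).g i) ∈ X)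
    (hmir : ∀ i : Fin 12, dz (slotInt i) (cubeInt c) < 0 → T G' q₀ (p.toV + mirQ (frameOf κ).g (frameOf κ).w i c) ∈ X)
    (hfar : ∀ i : Fin 12, 0 < dz (slotInt i) (cubeInt c) → T G' q₀ (p.toV + (frameOf κ).g i) ∉ X)
    (hcont : ∀ z ∈ X, dist (T G' q₀ p.toV) z = 1 →
      (∃ i : Fin 12, dz (slotInt i) (cubeInt c) ≤ 0 ∧ z = T G' q₀ (p.toV + (frameOf κ).g i)) ∨
      (∃ i : Fin 12, dz (slotInt i) (cubeInt c) < 0 ∧ z = T G' q₀ (p.toV + mirQ (frameOf κ).g (frameOf κ).w i c))) :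
    Inv X G' q₀ (addTwin st p κ c) where
  pres := by
    intro a ha
    rcases mem_addAll.1 ha with ha | ha
    · exact hinv.pres a ha
    · rcases List.mem_append.1 ha with ha | ha
      · obtain ⟨i, hi, rfl⟩ := mem_ownList.1 ha
        rw [TT_add_gOf]
        refine hown i ?_
        have := of_decide_eq_true hi; rw [sc_eq] at this; exact_mod_cast this
      · obtain ⟨i, hi, rfl⟩ := mem_mirList.1 ha
        rw [TT_add_mir3]
        refine hmir i ?_
        have := of_decide_eq_true hi; rw [sc_eq] at this; exact_mod_cast this
  nodup := nodup_addAll hinv.nodup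
  sat := hinv.sat
  dzn := by
    intro pd hpd
    rcases List.mem_cons.1 hpd with rfl | hpd
    · refine ⟨hinv.sat p hp, fun z hz hd => ?_⟩
      rcases hcont z hz hd with ⟨i, hi, rfl⟩ | ⟨i, hi, rfl⟩
      · refine ⟨Q3.add p (gOf (tabs κ) i), List.mem_append.2 (Or.inl (mem_ownList.2 ⟨i, ?_, rfl⟩)), (TT_add_gOf κ p i).symm⟩
        rw [decide_eq_true_iff, sc_eq]; exact_mod_cast hi
      · refine ⟨Q3.add p (mir3 (tabs κ) i c), List.mem_append.2 (Or.inr (mem_mirList.2 ⟨i, ?_, rfl⟩)), (TT_add_mir3 κ p i c).symm⟩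
        rw [decide_eq_true_iff, sc_eq]; exact_mod_cast hi
    · exact hinv.dzn pd hpd
  emp := by
    intro a ha
    rcases List.mem_append.1 ha with ha | ha
    · obtain ⟨i, hi, rfl⟩ := mem_farList.1 ha
      rw [TT_add_gOf]
      refine hfar i ?_
      have := of_decide_eq_true hi; rw [sc_eq] at this; exact_mod_cast this
    · exact hinv.emp a ha
  uns := hinv.uns

/-- Marking a contact with twelve contacts as saturated. -/
theorem inv_sat {st : St} (hinv : Inv X G' q₀ st) {x : Q3} (hx : TT G' q₀ x ∈ X) (h12 : (X.filter fun z => dist (TT G' q₀ x) z = 1).card = 12) :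
    Inv X G' q₀ { st with sat := x :: st.sat } where
  pres := hinv.pres
  nodup := hinv.nodup
  sat := by
    intro a ha
    rcases List.mem_cons.1 ha with rfl | ha
    · exact ⟨hx, h12⟩
    · exact hinv.sat a ha
  dzn := hinv.dzn
  emp := hinv.emp
  uns := hinv.uns

/-- Designating an unsaturated contact of the end ball. -/
theorem inv_uns {st : St} (hinv : Inv X G' q₀ st) {x : Q3} (hx : TT G' q₀ x ∈ X) (hd : Q3.d2 bQ x = 18)
    (h11 : (X.filter fun z => dist (TT G' q₀ x) z = 1).card ≤ 11) : Inv X G' q₀ { st with uns := some x } where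
  pres := hinv.pres
  nodup := hinv.nodup
  sat := hinv.sat
  dzn := hinv.dzn
  emp := hinv.emp
  uns := by intro u hu; cases hu; exact ⟨hx, hd, h11⟩

/-- Adding one present ball. -/
theorem inv_insert {st : St} (hinv : Inv X G' q₀ st) {x : Q3} (hx : TT G' q₀ x ∈ X) : Inv X G' q₀ { st with pres := insertV x st.pres } where
  pres := by
    intro a ha
    rcases mem_insertV.1 ha with rfl | ha
    · exact hx
    · exact hinv.pres a ha
  nodup := nodup_insertV hinv.nodup
  sat := hinv.sat
  dzn := hinv.dzn
  emp := hinv.emp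
  uns := hinv.uns

/-! ### §5 The free-ball step -/

/-- The ten balls of the free-ball pattern are distinct (both signs). -/
theorem tenList_nodup : ∀ σ ∈ [(1 : ℚ), -1], (tenList σ).Nodup := by decide +kernel

open scoped Classical in
/-- In the free-ball pattern there is an eleventh contact of the end ball, and it is one of the three candidates. -/
theorem exists_candidate (hyp : Hyp X G' q₀) {st : St} (hinv : Inv X G' q₀ st) {σ : ℚ} (hσ : σ = 1 ∨ σ = -1) (hfp : freePattern st σ = true) :
    TT G' q₀ ⟨6, 6, 0⟩ ∈ X ∨ TT G' q₀ ⟨4, 7, -σ⟩ ∈ X ∨ TT G' q₀ ⟨7, 4, -σ⟩ ∈ X := by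
  simp only [freePattern, Bool.and_eq_true, decide_eq_true_eq] at hfp
  obtain ⟨⟨⟨⟨hten, -⟩, hk⟩, hsat⟩, -⟩ := hfp
  have hσmem : σ ∈ [(1 : ℚ), -1] := by rcases hσ with rfl | rfl <;> simp
  -- the ten are distinct contacts of `b`
  have hten18 : ∀ v ∈ tenList σ, Q3.d2 bQ v = 18 := by
    have hσ2 : σ * σ = 1 := by rcases hσ with rfl | rfl <;> norm_num
    intro v hv
    simp only [tenList, kList, sList, m0, List.mem_append, List.mem_cons, List.not_mem_nil, or_false] at hv
    rcases hv with ((rfl | rfl | rfl | rfl | rfl) | (rfl | rfl | rfl | rfl)) | rfl <;> simp only [Q3.d2, Q3.dot, Q3.sub, bQ] <;>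
      first | linear_combination (9 : ℚ) * hσ2 | linear_combination (16 : ℚ) * hσ2 | norm_num
  set C := X.filter fun z => dist (TT G' q₀ bQ) z = 1 with hC
  set I := ((tenList σ).map (TT G' q₀)).toFinset with hI
  have hIC : I ⊆ C := by
    intro z hz
    rw [hI, List.mem_toFinset, List.mem_map] at hz
    obtain ⟨v, hv, rfl⟩ := hz
    exact mem_filter.2 ⟨hinv.pres v (hten v hv), (dist_TT_eq_one_iff G' q₀ bQ v).2 (hten18 v hv)⟩
  have hIcard : I.card = 10 := by
    rw [hI, List.card_toFinset, ((List.nodup_map_iff (TT_injective G' q₀)).2 (tenList_nodup σ hσmem)).dedup, List.length_map]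
    rcases hσ with rfl | rfl <;> rfl
  have hlt : I.card < C.card := by rw [hIcard, hC, hyp.deg]; norm_num
  obtain ⟨z, hzC, hzI⟩ := exists_mem_notMem_of_card_lt_card hlt
  obtain ⟨hz, hzb⟩ := mem_filter.1 hzC
  have hnew : ∀ u ∈ tenList σ, z ≠ TT G' q₀ u := by
    intro u hu hzu
    exact hzI (by rw [hI, List.mem_toFinset, List.mem_map]; exact ⟨u, hu, hzu.symm⟩)
  have hK : ∀ k ∈ kList, TT G' q₀ k ∈ X ∧ (X.filter fun z => dist (TT G' q₀ k) z = 1).card = 12 ∧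
      ∀ z ∈ X, dist (TT G' q₀ k) z = 1 → dist (TT G' q₀ bQ) z = 1 → ∃ u ∈ tenList σ, z = TT G' q₀ u := by
    intro k hkk
    obtain ⟨pd, hpd, hp1, hsub⟩ := hk k hkk
    obtain ⟨⟨hkX, hk12⟩, hcont⟩ := hinv.dzn pd hpd
    rw [hp1] at hkX hk12 hcont
    refine ⟨hkX, hk12, fun z' hz' hd hdb => ?_⟩
    obtain ⟨u, hu, rfl⟩ := hcont z' hz' hd
    exact ⟨u, hsub u hu ((dist_TT_eq_one_iff G' q₀ bQ u).1 hdb), rfl⟩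
  have hS : ∀ sb ∈ sList σ, TT G' q₀ sb ∈ X ∧ (X.filter fun z => dist (TT G' q₀ sb) z = 1).card = 12 := fun sb hsb => hinv.sat sb (hsat sb hsb)
  have hm : TT G' q₀ (m0 σ) ∈ X := hinv.pres _ (hten _ (by simp [tenList]))
  rcases free_ball G' q₀ hyp.gap hyp.sep hσ hK hS hm hz hzb hnew with h | h | h
  · exact Or.inl (h ▸ hz)
  · exact Or.inr (Or.inl (h ▸ hz))
  · exact Or.inr (Or.inr (h ▸ hz))

/-! ### §6 Soundness of the checker -/

open scoped Classical in
/-- **SOUNDNESS.**  No certificate is accepted from a state interpreted in `X`. -/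
theorem run_sound (hyp : Hyp X G' q₀) : ∀ (c : Cert) (st : St), Inv X G' q₀ st → run c st = true → False := by
  intro c
  induction c with
  | leaf w => intro st hinv h; exact false_of_checkW hyp hinv w h
  | e1 p κ j kF k1 k2 ihF ih1 ih2 =>
    intro st hinv h
    simp only [run, Bool.and_eq_true, decide_eq_true_eq] at h
    obtain ⟨⟨⟨⟨hj, hp⟩, hstar⟩, hF⟩, htw⟩ := h
    obtain ⟨hpX, hp12⟩ := hinv.sat p hp
    have hstar' := star_of_starOK hinv (j := ⟨j, hj⟩) hstar
    rcases e1_step G' q₀ hyp.e1 hyp.sep hp12 (frameOf κ) ⟨j, hj⟩ hstar' with ⟨hall, hcont⟩ | ⟨c, hown, hownX, hmir, hfar, hcont⟩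
    · exact ihF _ (inv_addFull hinv hp hall hcont) hF
    · have hc : (c : ℕ) ∈ (List.range 8).filter (ownSide j) := List.mem_filter.2 ⟨List.mem_range.2 c.2, ownSide_of ⟨j, hj⟩ c hown⟩
      split at htw
      · rename_i c₁ c₂ heq
        rw [heq] at hc
        simp only [Bool.and_eq_true] at htw
        simp only [List.mem_cons, List.not_mem_nil, or_false] at hc
        rcases hc with hc | hc
        · exact ih1 _ (hc ▸ inv_addTwin hinv hp hownX hmir hfar hcont) htw.1
        · exact ih2 _ (hc ▸ inv_addTwin hinv hp hownX hmir hfar hcont) htw.2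
      · exact Bool.false_ne_true htw
  | split x kU kS ihU ihS =>
    intro st hinv h
    simp only [run, Bool.and_eq_true, decide_eq_true_eq, Bool.not_eq_true', decide_eq_false_iff_not] at h
    obtain ⟨⟨⟨⟨hx, hd⟩, hne⟩, hU⟩, hS⟩ := h
    have hxX := hinv.pres x hx
    have hdist : dist (TT G' q₀ bQ) (TT G' q₀ x) = 1 := (dist_TT_eq_one_iff G' q₀ bQ x).2 hd
    by_cases h12 : (X.filter fun z => dist (TT G' q₀ x) z = 1).card = 12
    · exact ihS _ (inv_sat hinv hxX h12) hS
    · have hle : (X.filter fun z => dist (TT G' q₀ x) z = 1).card ≤ 11 := by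
        have := card_filter_dist_eq_one_le_twelve X hyp.sep (TT G' q₀ x); omega
      cases hu : st.uns with
      | none => rw [hu] at hU; exact ihU _ (inv_uns hinv hxX hd hle) hU
      | some u =>
        obtain ⟨huX, hud, hule⟩ := hinv.uns u hu
        have heq := hyp.one _ hxX _ huX hdist ((dist_TT_eq_one_iff G' q₀ bQ u).2 hud) hle hule
        exact hne (by rw [hu, TT_injective G' q₀ heq])
  | free σ k1 k2 k3 ih1 ih2 ih3 =>
    intro st hinv h
    simp only [run, Bool.and_eq_true, Bool.or_eq_true, decide_eq_true_eq] at h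
    obtain ⟨⟨⟨⟨hσ, hfp⟩, h1⟩, h2⟩, h3⟩ := h
    rcases exists_candidate hyp hinv hσ hfp with hz | hz | hz
    · exact ih1 _ (inv_insert hinv hz) h1
    · exact ih2 _ (inv_insert hinv hz) h2
    · exact ih3 _ (inv_insert hinv hz) h3
  | vac σ sw =>
    intro st hinv h
    simp only [run, Bool.and_eq_true, Bool.or_eq_true, decide_eq_true_eq] at h
    obtain ⟨hσ, hvp⟩ := h
    simp only [vacPattern, decide_eq_true_eq] at hvp
    exact false_of_vacLeaf G' q₀ hyp.gap hyp.cap hyp.sep hyp.bmem hyp.deg hyp.one hσ sw (fun v hv => hinv.pres _ (hvp v hv))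

end FullCensus


end TailResidue

end Summit.Ventures.Crystal3D.Theorems

end
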